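import Summits.QuantumFields.YangMills.Theorems.LuscherReductionTwistedTraceScalingOneSiteNearTop
import HarnessLib

/-!
# ★★ A LOCALISED one-site near-eigenfamily at LEVEL `k`: `φ₀ … φ_k` gauge invariant, supported in `{orbitDist < 13·B^{-1/5}}`, with
# `⟨φ_a, K_B φ_a⟩ ≥ e^{−ελ_b}μ_k(B)‖φ_a‖²` for every combination `φ_a = Σ aᵢφᵢ`, nondegenerate
# (lane A of S-BASE, crux `TwistedTraceScaling` stmt-QuantumFields-20203, line «twolattice», stub `stub_fixedLatticeTraceLaw`; the spectral input of the LEVEL-`k` FLOOR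
# `e^{−ελ_b}·σ·μ_k ≤ λ_k` of BO_lower(L) ∕ COARSE-LOWER(L); lead g23; `HANDOFF-g23.md`)

The level-`k` twin of ✓`exists_localized_near_top` (`…OneSiteNearTop`, the `k = 0` input of the FLOOR clause).  Same proof, no new analysis: in place of a near-maximiser of
the one-site Rayleigh quotient take the exact physical eigenfamily `e₀ … e_k` (✓`exists_isPhys_eigenfamily_of_pos` at `L = 1`, forms ✓`forms_of_eigenfamily_lat`, hence
`μ_k·Σaᵢ² ≤ ⟨ψ_a, K_Bψ_a⟩`, `‖ψ_a‖² = Σaᵢ²` for `ψ_a = Σ aᵢeᵢ`, ✓`levelValue_le_of_le`); for every coefficient vector run the IMS split ✓`qform_le_inner_outer_lat` at `L = 1` with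
`innerPhase (13 B^{-1/5})`, the one-site SHELL GAIN ✓`oneSite_shell_gain` on the `sin`-piece, the absolute floor AT LEVEL `k` ✓`oneSiteAbsLower_of_eigenfunctions`
(`linkCE·e^{−E_{k+1}λ_b − Cλ_b²} ≤ μ_k`, AL1 ✓`LuscherHamiltonianEigenfunctions_holds k`), the endgame ✓`near_top_algebra` (abstract in the reference value, here `μ_k`), and ONE
twist copy (✓`l2_inner_eq`, ✓`abs_qform_inner_sub_le`, ✓`crossBound_eventually_small`, `uniformFloorConst·latCE ≤ μ₀ ≤ linkCE ≤ (1+ζ)μ_k`).  Output: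
★★ `exists_localized_near_level k ε` — eventually in `B`, a family `φᵢ = innerCut δ · eᵢ` (`δ = 13B^{-1/5}`), measurable, bounded, gauge invariant, supported in
`{orbitDist < 13·B^{-1/5}}`, with `‖Σaᵢφᵢ‖² > 0` for `a ≠ 0` and `e^{−ελ_b(B)}·μ_k(B)·‖Σaᵢφᵢ‖² ≤ ⟨Σaᵢφᵢ, K_B Σaᵢφᵢ⟩` for EVERY `a`.
HONEST FRAMING: a one-site (finite-dimensional) statement, consequence of the PROVED crux ONE; an input of the level-`k` floor of BO_lower(L), not the floor; not a gap, not Clay.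
-/

set_option autoImplicit false

noncomputable section

open MeasureTheory Filter Topology Real
open scoped BigOperators
open Literature.MathematicalPhysics.QuantumFieldTheory
open Literature.MathematicalPhysics.QuantumLattice
open Literature.Analysis.OperatorTheory.YMMatrixModel

namespace Summit.QuantumFields.YangMills.Theorems.FemtoTransferGap

/-! ## ★★ The localised near-eigenfamily at level `k` -/

set_option maxHeartbeats 1600000 in
/-- ★★ **A LOCALISED ONE-SITE NEAR-EIGENFAMILY AT LEVEL `k`.**  For every `k` and `ε > 0`, eventually in `B`, there are bounded measurable gauge-invariant one-site functions
`φ₀, …, φ_k` supported in `{orbitDist U < 13·B^{-1/5}}` such that every combination `φ_a = Σ aᵢφᵢ` with `a ≠ 0` has `‖φ_a‖² > 0`, and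
`e^{−ελ_b(B)}·μ_k(B)·‖φ_a‖² ≤ ⟨φ_a, K_B φ_a⟩` for every `a`. [cite: Luscher1983, §2] [cite: SimonB1983DiscreteSpectrum, §3] -/
theorem exists_localized_near_level (k : ℕ) (ε : ℝ) (hε : 0 < ε) : ∃ B₀ : ℝ, ∀ B : ℝ, B₀ ≤ B →
    ∃ φ : Fin (k + 1) → (GaugeConfig 3 1 SU2 → ℝ),
      (∀ i, Measurable (φ i)) ∧ (∀ i, ∃ C : ℝ, ∀ U, |φ i U| ≤ C) ∧
      (∀ i (g : Site 3 1 → SU2) (U : GaugeConfig 3 1 SU2), φ i (gaugeTransform g U) = φ i U) ∧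
      (∀ i U, φ i U ≠ 0 → orbitDist U < 13 * B ^ (-(1 / 5 : ℝ))) ∧
      ∀ a : Fin (k + 1) → ℝ,
        (a ≠ 0 → 0 < l2 (fun U => ∑ i, a i * φ i U) (fun U => ∑ i, a i * φ i U)) ∧
        Real.exp (-(ε * bareLambda B)) * levelValue su2Rep 1 B k * l2 (fun U => ∑ i, a i * φ i U) (fun U => ∑ i, a i * φ i U) ≤
          qform su2Rep B (fun U => ∑ i, a i * φ i U) (fun U => ∑ i, a i * φ i U) := by
  -- WLOG `ε ≤ 1`
  set ε' : ℝ := min ε 1 with hε'def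
  have hε' : 0 < ε' := lt_min hε one_pos
  have hε'1 : ε' ≤ 1 := min_le_right _ _
  have hε'ε : ε' ≤ ε := min_le_left _ _
  -- constants
  obtain ⟨Bs, hshell⟩ := oneSite_shell_gain
  obtain ⟨CA, BA, hAbs⟩ := oneSiteAbsLower_of_eigenfunctions (LuscherHamiltonianEigenfunctions_holds k)
  obtain ⟨Bc, hcross⟩ := crossBound_eventually_small (L := 1) (m := 1 / 2) (by norm_num) (ε := ε' / 4) (by positivity)
  have hE₁ : 0 ≤ physLevel (k + 1) := physLevel_nonneg (by omega)
  set A : ℝ := physLevel (k + 1) + |CA| with hA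
  have hA0 : 0 ≤ A := by rw [hA]; positivity
  set ce : ℝ := 864 * π ^ 2 / 169 with hce
  have hce0 : 0 < ce := by rw [hce]; positivity
  -- the threshold in `u = B^{1/10}`
  set u₀ : ℝ := max (max 100 (2 * (320 * (A + 1)) ^ 3)) (max (320 * ce + 1) (12 * ce / ε' + 1)) with hu₀
  have hu₀1 : 100 ≤ u₀ := (le_max_left _ _).trans (le_max_left _ _)
  have hu₀0 : 0 ≤ u₀ := le_trans (by norm_num) hu₀1
  refine ⟨max (max (max Bs BA) (max Bc 2)) (u₀ ^ 10), fun B hB => ?_⟩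
  have hBs : Bs ≤ B := (((le_max_left _ _).trans (le_max_left _ _)).trans (le_max_left _ _)).trans hB
  have hBA : BA ≤ B := (((le_max_right _ _).trans (le_max_left _ _)).trans (le_max_left _ _)).trans hB
  have hBc : Bc ≤ B := (((le_max_left _ _).trans (le_max_right _ _)).trans (le_max_left _ _)).trans hB
  have hB2 : 2 ≤ B := (((le_max_right _ _).trans (le_max_right _ _)).trans (le_max_left _ _)).trans hB
  have hBu : u₀ ^ 10 ≤ B := (le_max_right _ _).trans hB
  have hB0 : 0 < B := by linarith only [hB2]
  have hB1 : 1 ≤ B := by linarith only [hB2]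
  -- facts about `B` (collected before we substitute `B = u¹⁰`)
  have hshellB := hshell B hBs
  have hAbsB := hAbs B hBA
  have hcrossB := hcross B hBc
  have hlamcube : B * bareLambda B ^ 3 = 2 := bareLambda_cube hB0
  obtain ⟨hlam0, hlam1⟩ := bareLambda_pos_le_one hB2
  have hμ0 : 0 < levelValue su2Rep 1 B k := levelValue_su2Rep_pos hB0 k
  have hℓ0 : 0 ≤ linkCE B := (linkCE_pos hB0.le).le
  have hunif := levelValue_zero_ge_uniform (L := 1) hB1
  have htopℓ : levelValue su2Rep 1 B 0 ≤ linkCE B :=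
    levelValue_zero_le_of_forall_rayleigh_le su2Rep B hℓ0 fun _ hψ _ => qform_le_linkCE_mul_l2 hB0.le hψ
  -- the exact physical eigenfamily and its forms (before substituting `B = u¹⁰`)
  obtain ⟨e, he, hon, heig⟩ := exists_isPhys_eigenfamily_of_pos (L := 1) hB0 k
  have hfloorK : ∀ cv : Fin (k + 1) → ℝ,
      levelValue su2Rep 1 B k * ∑ i, cv i ^ 2 ≤ qform su2Rep B (fun U => ∑ i, cv i * e i U) (fun U => ∑ i, cv i * e i U) ∧
      l2 (fun U => ∑ i, cv i * e i U) (fun U => ∑ i, cv i * e i U) = ∑ i, cv i ^ 2 := fun cv => by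
    obtain ⟨hn, hq⟩ := forms_of_eigenfamily_lat he hon heig cv
    refine ⟨?_, hn⟩
    rw [hq, Finset.mul_sum]
    refine Finset.sum_le_sum fun i _ => mul_le_mul_of_nonneg_right ?_ (sq_nonneg _)
    exact levelValue_le_of_le hB0 (Nat.le_of_lt_succ i.2)
  obtain ⟨hBdef, hu, hfifth⟩ := ShellAsymp.tenth_root_facts hu₀0 hBu hB0
  set u : ℝ := B ^ ((1 : ℝ) / 10) with hudef
  clear_value u
  subst hBdef
  have hu100 : 100 ≤ u := hu₀1.trans hu
  have hu0 : 0 < u := by linarith only [hu100]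
  have hu1 : 1 ≤ u := by linarith only [hu100]
  have hui : u⁻¹ = 1 / u := inv_eq_one_div u
  -- names
  set μ : ℝ := levelValue su2Rep 1 (u ^ 10) k with hμdef
  set ℓ : ℝ := linkCE (u ^ 10) with hℓdef
  set lam : ℝ := bareLambda (u ^ 10) with hlamdef
  -- scales: `t = B^{-1/5} = u⁻²`, `δ = 13t`, `g = t√t/40 = u⁻³/40`
  set t : ℝ := u⁻¹ ^ 2 with htdef
  have htB : (u ^ 10) ^ (-(1 / 5 : ℝ)) = t := hfifth
  have htu : t = 1 / u ^ 2 := by rw [htdef, hui]; ring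
  have ht0 : 0 < t := by rw [htu]; positivity
  have hsqt : Real.sqrt t = u⁻¹ := by rw [htdef, Real.sqrt_sq (by positivity)]
  have ht5000 : t ≤ 1 / 5000 := by
    rw [htu, div_le_div_iff₀ (by positivity) (by norm_num)]; nlinarith only [hu100]
  set δ : ℝ := 13 * t with hδdef
  have hδ0 : 0 < δ := by rw [hδdef]; positivity
  have hδlt : ((1 : ℕ) : ℝ) * (δ + 1 / 2) < 2 := by rw [Nat.cast_one, one_mul, hδdef]; linarith only [ht5000]
  have hLδ : ((1 : ℕ) : ℝ) * δ < 2 := by rw [Nat.cast_one, one_mul, hδdef]; linarith only [ht5000, ht0]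
  set g : ℝ := t * Real.sqrt t / 40 with hgdef
  have hgu : g = 1 / (40 * u ^ 3) := by rw [hgdef, hsqt, htu, hui]; field_simp
  have hg0 : 0 < g := by rw [hgu]; positivity
  have hg1 : g ≤ 1 := by
    rw [hgu, div_le_one (by positivity)]
    have := one_le_pow₀ (M₀ := ℝ) (a := u) (n := 3) hu1
    linarith only [this]
  -- `ℓ ≤ (1+ζ) μ`, `1 + ζ = e^x`, `x = E₁λ_b + |CA|λ_b²`
  set x : ℝ := physLevel (k + 1) * lam + |CA| * lam ^ 2 with hxdef
  have hx0 : 0 ≤ x := by rw [hxdef]; positivity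
  have hxA : x ≤ A * lam := by
    have hl2 : lam ^ 2 ≤ lam := by nlinarith only [hlam0, hlam1]
    have : |CA| * lam ^ 2 ≤ |CA| * lam := mul_le_mul_of_nonneg_left hl2 (abs_nonneg _)
    rw [hxdef, hA]; linarith only [this]
  have hℓζ : ℓ ≤ Real.exp x * μ := by
    have h0 : ℓ * Real.exp (-(physLevel (k + 1) * lam) - CA * lam ^ 2) ≤ μ := by
      have h := hAbsB
      rw [hℓdef, linkCE, card_edge_one]
      simpa using h
    have h1 : Real.exp (-x) ≤ Real.exp (-(physLevel (k + 1) * lam) - CA * lam ^ 2) := by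
      refine Real.exp_le_exp.mpr ?_
      have := mul_le_mul_of_nonneg_right (le_abs_self CA) (sq_nonneg lam)
      rw [hxdef]; linarith only [this]
    have h2 : ℓ * Real.exp (-x) ≤ μ := (mul_le_mul_of_nonneg_left h1 hℓ0).trans h0
    have h3 := mul_le_mul_of_nonneg_right h2 (Real.exp_pos x).le
    rw [mul_assoc, ← Real.exp_add, neg_add_cancel, Real.exp_zero, mul_one] at h3
    linarith only [h3]
  set ζ : ℝ := Real.exp x - 1 with hζdef
  have hζ0 : 0 ≤ ζ := by rw [hζdef]; linarith only [Real.add_one_le_exp x, hx0]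
  have hℓζ' : ℓ ≤ (1 + ζ) * μ := by rw [hζdef]; linarith only [hℓζ]
  -- `λ_b ≤ κ u⁻³`, `κ = 1/(320(A+1))`: cube both sides, `λ_b³ = 2/u¹⁰`
  set κ : ℝ := 1 / (320 * (A + 1)) with hκdef
  have hκ0 : 0 < κ := by rw [hκdef]; positivity
  have hlam3 : lam ^ 3 = 2 / u ^ 10 := by
    rw [hlamdef, eq_div_iff (by positivity)]; linarith only [hlamcube]
  have hlamκ : lam ≤ κ * u⁻¹ ^ 3 := by
    have hu3 : 2 * (320 * (A + 1)) ^ 3 ≤ u := ((le_max_right _ _).trans (le_max_left _ _)).trans hu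
    have hκ3 : κ ^ 3 * (320 * (A + 1)) ^ 3 = 1 := by rw [hκdef]; field_simp
    have hcube : lam ^ 3 ≤ (κ * u⁻¹ ^ 3) ^ 3 := by
      rw [hlam3, hui]
      have e2 : (κ * (1 / u) ^ 3) ^ 3 = κ ^ 3 * u / u ^ 10 := by field_simp
      rw [e2, div_le_div_iff_of_pos_right (by positivity)]
      have : κ ^ 3 * (2 * (320 * (A + 1)) ^ 3) ≤ κ ^ 3 * u := mul_le_mul_of_nonneg_left hu3 (by positivity)
      linarith only [this, hκ3]
    exact le_of_pow_le_pow_left₀ (by norm_num) (by positivity) hcube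
  -- tolerance `η = ce u⁻⁶`
  set η : ℝ := ce * u⁻¹ ^ 6 with hηdef
  have hη0 : 0 < η := by rw [hηdef]; positivity
  -- smallness: `ζ ≤ g/4`, `η ≤ g/8`
  have hζg : ζ ≤ g / 4 := by
    have hAl : A * lam ≤ A * 1 := mul_le_mul_of_nonneg_left hlam1 hA0
    have hx1 : x ≤ 1 := by
      have hAκ : A * (κ * u⁻¹ ^ 3) ≤ 1 := by
        rw [hκdef, hui]
        have e : A * (1 / (320 * (A + 1)) * (1 / u) ^ 3) = (A / (A + 1)) * (1 / (320 * u ^ 3)) := by field_simp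
        rw [e]
        have hA1 : A / (A + 1) ≤ 1 := div_le_one_of_le₀ (by linarith only [hA0]) (by linarith only [hA0])
        have hs : 1 / (320 * u ^ 3) ≤ 1 := by
          rw [div_le_one (by positivity)]
          have := one_le_pow₀ (M₀ := ℝ) (a := u) (n := 3) hu1
          linarith only [this]
        calc A / (A + 1) * (1 / (320 * u ^ 3)) ≤ 1 * 1 := mul_le_mul hA1 hs (by positivity) zero_le_one
          _ = 1 := one_mul 1
      exact hxA.trans ((mul_le_mul_of_nonneg_left hlamκ hA0).trans hAκ)
    have hex : Real.exp x - 1 ≤ 2 * x := by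
      have := Real.abs_exp_sub_one_le (x := x) (by rw [abs_of_nonneg hx0]; exact hx1)
      rw [abs_of_nonneg hx0] at this
      exact (abs_le.mp this).2
    have h4 : x ≤ A * (κ * u⁻¹ ^ 3) := hxA.trans (mul_le_mul_of_nonneg_left hlamκ hA0)
    have h5 : 2 * (A * (κ * u⁻¹ ^ 3)) ≤ g / 4 := by
      rw [hκdef, hgu, hui]
      have hA1 : A / (A + 1) ≤ 1 := div_le_one_of_le₀ (by linarith only [hA0]) (by linarith only [hA0])
      have e : 2 * (A * (1 / (320 * (A + 1)) * (1 / u) ^ 3)) = (A / (A + 1)) * (1 / (40 * u ^ 3) / 4) := by field_simp; ring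
      rw [e]
      exact mul_le_of_le_one_left (by positivity) hA1
    rw [hζdef]; linarith only [hex, h4, h5]
  have hηg : η ≤ g / 8 := by
    have hu3 : 320 * ce + 1 ≤ u := ((le_max_left _ _).trans (le_max_right _ _)).trans hu
    rw [hηdef, hgu, hui]
    have e1 : ce * (1 / u) ^ 6 = ce / u ^ 6 := by field_simp
    have e2 : 1 / (40 * u ^ 3) / 8 = 1 / (320 * u ^ 3) := by field_simp; ring
    rw [e1, e2, div_le_div_iff₀ (by positivity) (by positivity), one_mul]
    have hu31 : 1 ≤ u ^ 3 := one_le_pow₀ hu1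
    have hcu : 320 * ce ≤ u ^ 3 := by
      have := le_self_pow₀ hu1 (show (3 : ℕ) ≠ 0 by norm_num)
      linarith only [hu3, this]
    have hu30 : 0 ≤ u ^ 3 := by positivity
    have : ce * (320 * u ^ 3) ≤ u ^ 3 * u ^ 3 := by nlinarith only [hcu, hu30]
    calc ce * (320 * u ^ 3) ≤ u ^ 3 * u ^ 3 := this
      _ = u ^ 6 := by ring
  have hsmall : ζ + η + η * (1 + ζ) < g := by
    have hζ1 : ζ ≤ 1 := hζg.trans (by linarith only [hg1, hg0])
    have : η * (1 + ζ) ≤ 2 * η := by nlinarith only [hζ1, hη0]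
    linarith only [this, hζg, hηg, hg0]
  have hζ1 : ζ ≤ 1 := hζg.trans (by linarith only [hg1, hg0])
  -- precision: `3η ≤ y/2` with `y = ε'λ_b/2 ≤ 1/2`, so `e^{−y} ≤ 1 − y/2 ≤ 1 − 3η`
  set y : ℝ := ε' * lam / 2 with hydef
  have hy0 : 0 ≤ y := by rw [hydef]; positivity
  have hy12 : y ≤ 1 / 2 := by
    rw [hydef]
    have := mul_le_mul hε'1 hlam1 hlam0.le zero_le_one
    linarith only [this]
  have h3η : 3 * η ≤ y / 2 := by
    -- `λ_b ≥ u⁻⁴` (cube: `2/u¹⁰ ≥ u⁻¹²`) and `12 ce u⁻⁶ ≤ ε' u⁻⁴` iff `12 ce/ε' ≤ u²`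
    have hlam4 : u⁻¹ ^ 4 ≤ lam := by
      have hcube : (u⁻¹ ^ 4) ^ 3 ≤ lam ^ 3 := by
        rw [hlam3, hui]
        have e : ((1 / u) ^ 4) ^ 3 = 1 / u ^ 12 := by field_simp
        rw [e, div_le_div_iff₀ (by positivity) (by positivity), one_mul]
        have h10 : 0 ≤ u ^ 10 := by positivity
        have h12 : u ^ 12 = u ^ 10 * u ^ 2 := by ring
        rw [h12]
        have hu2sq : (1 : ℝ) ≤ u ^ 2 := one_le_pow₀ hu1
        have := mul_le_mul_of_nonneg_left hu2sq h10
        linarith only [this, h10]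
      exact le_of_pow_le_pow_left₀ (by norm_num) hlam0.le hcube
    have hu2 : 12 * ce / ε' + 1 ≤ u := ((le_max_right _ _).trans (le_max_right _ _)).trans hu
    have hu2' : 12 * ce ≤ ε' * u := by
      have h' : 12 * ce / ε' ≤ u := by linarith only [hu2]
      rw [div_le_iff₀ hε'] at h'
      linarith only [h']
    have key : 3 * ce * u⁻¹ ^ 2 ≤ ε' / 4 := by
      rw [hui]
      have e : 3 * ce * (1 / u) ^ 2 = 3 * ce / u ^ 2 := by field_simp
      rw [e, div_le_iff₀ (by positivity)]
      have hu_sq : u ≤ u ^ 2 := by nlinarith only [hu1]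
      have := mul_le_mul_of_nonneg_left hu_sq hε'.le
      linarith only [hu2', this]
    have e : 3 * η = (3 * ce * u⁻¹ ^ 2) * u⁻¹ ^ 4 := by rw [hηdef]; ring
    rw [e, hydef]
    calc (3 * ce * u⁻¹ ^ 2) * u⁻¹ ^ 4 ≤ (ε' / 4) * lam := mul_le_mul key hlam4 (by positivity) (by positivity)
      _ = ε' * lam / 2 / 2 := by ring
  have hprec : Real.exp (-y) ≤ 1 - η - η * (1 + ζ) := by
    have hζ1 : ζ ≤ 1 := hζg.trans (by linarith only [hg1, hg0])
    have h1' : η * (1 + ζ) ≤ 2 * η := by nlinarith only [hζ1, hη0]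
    have h2' := exp_neg_le_one_sub_half hy0 hy12
    linarith only [h1', h2', h3η]
  -- the copies' cross terms: `28 cB ≤ (ε'/4)λ_b·(c_unif·latCE) ≤ (ε'/4)λ_b·μ₀ ≤ (ε'/4)λ_b·ℓ ≤ (ε'/2)λ_b·μ_k`
  have hcB : 28 * crossBound 1 (u ^ 10) (1 / 2) ≤ ε' / 2 * lam * μ := by
    have h := hcrossB
    have e1 : ((1 : ℕ) : ℝ) ^ 3 * u ^ 10 = u ^ 10 := by rw [Nat.cast_one, one_pow, one_mul]
    rw [e1] at h
    have hch : uniformFloorConst 1 * latCE 1 (u ^ 10) ≤ 2 * μ :=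
      hunif.trans (htopℓ.trans (hℓζ'.trans (by nlinarith only [hζ1, hμ0])))
    calc 28 * crossBound 1 (u ^ 10) (1 / 2) ≤ ε' / 4 * lam * (uniformFloorConst 1 * latCE 1 (u ^ 10)) := h
      _ ≤ ε' / 4 * lam * (2 * μ) := mul_le_mul_of_nonneg_left hch (by positivity)
      _ = ε' / 2 * lam * μ := by ring
  -- THE FAMILY: `F i = innerCut δ · e i`
  obtain ⟨F, hF⟩ : ∃ F : Fin (k + 1) → (GaugeConfig 3 1 SU2 → ℝ), F = fun i V => innerCut δ V * e i V := ⟨_, rfl⟩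
  refine ⟨F, fun i => by rw [hF]; exact measurable_innerCut_mul δ (he i), fun i => ?_, fun i => by rw [hF]; exact innerCut_mul_gaugeTransform δ (he i),
    fun i U hU => ?_, fun cv => ?_⟩
  · obtain ⟨C, hC⟩ := (he i).bounded
    exact ⟨C, by rw [hF]; exact abs_innerCut_mul_le δ hC⟩
  · rw [hF] at hU
    rw [htB, ← hδdef]; exact orbitDist_lt_of_innerCut_mul_ne_zero hδ0 (e i) hU
  -- the combination `ψ = Σ cvᵢ eᵢ` and its cut-off `Σ cvᵢ Fᵢ = innerCut δ · ψ`
  set ψ : GaugeConfig 3 1 SU2 → ℝ := fun U => ∑ i, cv i * e i U with hψdef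
  have hψ : IsPhys ψ := isPhys_sum_mul_lat Finset.univ e he cv
  have hin : (fun U => ∑ i, cv i * F i U) = fun V => innerCut δ V * ψ V := by
    rw [hF]; funext U
    show ∑ i, cv i * (innerCut δ U * e i U) = innerCut δ U * ∑ i, cv i * e i U
    rw [Finset.mul_sum]
    exact Finset.sum_congr rfl fun i _ => by ring
  rw [hin]
  by_cases hcv : cv = 0
  · -- the zero combination
    have hψ0 : ψ = fun _ => 0 := by funext U; simp [hψdef, hcv]
    have hφ0 : (fun V => innerCut δ V * ψ V) = fun _ => (0 : ℝ) := by funext V; rw [hψ0, mul_zero]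
    rw [hφ0]
    refine ⟨fun h => absurd hcv h, ?_⟩
    simp [l2, qform]
  obtain ⟨hqψ, hnψ⟩ := hfloorK cv
  have hsumpos : 0 < ∑ i, cv i ^ 2 := by
    obtain ⟨i, hi⟩ := Function.ne_iff.mp hcv
    exact lt_of_lt_of_le (sq_pos_iff.mpr hi) (Finset.single_le_sum (fun j _ => sq_nonneg (cv j)) (Finset.mem_univ i))
  have hψpos : 0 < l2 ψ ψ := by rw [hnψ]; exact hsumpos
  have hnear : μ * (1 - η) * l2 ψ ψ ≤ qform su2Rep (u ^ 10) ψ ψ := by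
    rw [hnψ]
    have : 0 ≤ μ * η * ∑ i, cv i ^ 2 := by positivity
    linarith only [hqψ, this]
  obtain ⟨Cψ, hCψ⟩ := hψ.bounded
  -- IMS split with `innerPhase δ`
  have hIMS := qform_le_inner_outer_lat (L := 1) hB0 hδ0 hψ
  set a : ℝ := l2 (fun U => Real.cos (innerPhase δ U) * ψ U) (fun U => Real.cos (innerPhase δ U) * ψ U) with hadef
  set b : ℝ := l2 (fun U => Real.sin (innerPhase δ U) * ψ U) (fun U => Real.sin (innerPhase δ U) * ψ U) with hbdef
  set qC : ℝ := qform su2Rep (u ^ 10) (fun U => Real.cos (innerPhase δ U) * ψ U) (fun U => Real.cos (innerPhase δ U) * ψ U) with hqCdef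
  set qS : ℝ := qform su2Rep (u ^ 10) (fun U => Real.sin (innerPhase δ U) * ψ U) (fun U => Real.sin (innerPhase δ U) * ψ U) with hqSdef
  have hab : a + b = l2 ψ ψ := l2_cos_mul_add_l2_sin_mul (measurable_innerPhase δ) hψ
  have ha0 : 0 ≤ a := l2_self_nonneg_lat _
  have hb0 : 0 ≤ b := l2_self_nonneg_lat _
  -- the IMS error coefficient is `η ℓ`
  have hcoef : (1 / 2) * ((Fintype.card (Edge 3 1) : ℝ) ^ 2 * (8 * π / δ) ^ 2 * (3 / u ^ 10) * latCE 1 (u ^ 10)) = η * ℓ := by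
    have hlat : latCE 1 (u ^ 10) = ℓ := by rw [hℓdef, latCE, linkCE]
    rw [hlat, card_edge_one, hηdef, hce, hδdef, htu, hui]
    field_simp
    ring
  have h1 : μ * (1 - η) * (a + b) ≤ qC + qS + η * ℓ * (a + b) := by
    rw [hab]; rw [hcoef] at hIMS; linarith only [hIMS, hnear]
  -- shell gain on the `sin`-piece
  have hsin0 : ∀ U : GaugeConfig 3 1 SU2, ‖zmCoord 1 U‖ < t → Real.sin (innerPhase δ U) * ψ U = 0 := fun U hU => by
    rw [sin_innerPhase_eq_zero_of_zmCoord_le hδ0 (by rw [hδdef]; linarith only [hU, ht0]), zero_mul]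
  have hsm : Measurable fun U : GaugeConfig 3 1 SU2 => Real.sin (innerPhase δ U) * ψ U :=
    (Real.continuous_sin.measurable.comp (measurable_innerPhase δ)).mul hψ.measurable
  have hsb : ∃ C : ℝ, ∀ U : GaugeConfig 3 1 SU2, |Real.sin (innerPhase δ U) * ψ U| ≤ C :=
    ⟨Cψ, fun U => by rw [abs_mul]; exact (mul_le_mul (Real.abs_sin_le_one _) (hCψ U) (abs_nonneg _) zero_le_one).trans (by rw [one_mul])⟩
  have h2 : qS ≤ ℓ * (1 - g) * b := by
    have h := hshellB t htB.le ht5000 _ hsm hsb hsin0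
    rw [hgdef]; exact h
  -- the `cos`-piece is physical: crude bound `qC ≤ ℓ a`
  have hcosPhys : IsPhys (fun U : GaugeConfig 3 1 SU2 => Real.cos (innerPhase δ U) * ψ U) :=
    hψ.mul_of_invariant (Real.continuous_cos.measurable.comp (measurable_innerPhase δ)) (fun U => Real.abs_cos_le_one _)
      (fun g U => by rw [innerPhase_gaugeTransform]) (fun kk z hz U => by rw [innerPhase_twist δ kk hz])
  have h3 : qC ≤ ℓ * a := qform_le_linkCE_mul_l2 hB0.le hcosPhys
  obtain ⟨hqC, hapos⟩ := near_top_algebra hμ0 ha0 hb0 (by rw [hab]; exact hψpos) hℓζ' hζ0 hη0.le hη0.le hg1 h1 h2 h3 hsmall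
  have hqC' : Real.exp (-y) * μ * a ≤ qC := by
    have := mul_le_mul_of_nonneg_right hprec (mul_nonneg hμ0.le ha0)
    have e : (1 - η - η * (1 + ζ)) * (μ * a) = μ * (1 - η - η * (1 + ζ)) * a := by ring
    rw [e] at this
    linarith only [this, hqC]
  -- ONE COPY: `φ = innerCut δ · ψ`, `a = 8‖φ‖²`, `qC ≤ 8 qform φ + 56 cB ‖φ‖²`, `28 cB ≤ (ε'/2) λ_b μ`
  set φ : GaugeConfig 3 1 SU2 → ℝ := fun V => innerCut δ V * ψ V with hφdef
  have hl2φ : a = 8 * l2 φ φ := l2_inner_eq hδ0 hLδ hψ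
  have hqφ := abs_qform_inner_sub_le hB0.le hδ0 (by norm_num : (0:ℝ) ≤ 1 / 2) hδlt hψ
  rw [abs_le] at hqφ
  have hnφ0 : 0 ≤ l2 φ φ := l2_self_nonneg_lat _
  have hnφ : 0 < l2 φ φ := by rw [hl2φ] at hapos; linarith only [hapos]
  refine ⟨fun _ => hnφ, ?_⟩
  -- `qform φ ≥ (e^{−y} μ − 7 cB)‖φ‖² ≥ e^{−2y} μ ‖φ‖² ≥ e^{−ελ_b} μ ‖φ‖²`
  have hstep : (Real.exp (-y) * μ - 7 * crossBound 1 (u ^ 10) (1 / 2)) * l2 φ φ ≤ qform su2Rep (u ^ 10) φ φ := by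
    have h' := hqφ.2
    rw [hl2φ] at hqC'
    linarith only [h', hqC']
  have hgap : y / 4 * μ ≤ (Real.exp (-y) - Real.exp (-(2 * y))) * μ :=
    mul_le_mul_of_nonneg_right (exp_neg_sub_exp_neg_two_ge hy0 hy12) hμ0.le
  have h7 : 7 * crossBound 1 (u ^ 10) (1 / 2) ≤ y / 4 * μ := by rw [hydef]; linarith only [hcB]
  have hεy : Real.exp (-(ε * lam)) ≤ Real.exp (-(2 * y)) := by
    refine Real.exp_le_exp.mpr ?_
    have := mul_le_mul_of_nonneg_right hε'ε hlam0.le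
    rw [hydef]; linarith only [this]
  calc Real.exp (-(ε * bareLambda (u ^ 10))) * levelValue su2Rep 1 (u ^ 10) k * l2 φ φ = Real.exp (-(ε * lam)) * μ * l2 φ φ := rfl
    _ ≤ Real.exp (-(2 * y)) * μ * l2 φ φ := by gcongr
    _ ≤ (Real.exp (-y) * μ - 7 * crossBound 1 (u ^ 10) (1 / 2)) * l2 φ φ := by
        refine mul_le_mul_of_nonneg_right ?_ hnφ0; linarith only [hgap, h7]
    _ ≤ qform su2Rep (u ^ 10) φ φ := hstep

end Summit.QuantumFields.YangMills.Theorems.FemtoTransferGap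

end
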